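import Summits.Ventures.DiscreteObjects.PP12.FanoFiveSignSystem

/-!
# PP(12), order 5: symmetries of designs g10's sign/Gram system — duality, gauge, relabelling (kernel; soundness of the engines' class enumeration)
Framing: lottery ticket; floor = certified bounds/negative ranges.

Cell pub-namedobj (venture DiscreteObjects), target (M), designs gen 17. Designs g10's engines do not enumerate all `2^28` tangent-matching sign
patterns `m`: engine 2 runs over `280` class representatives (gauge `×` collineation group of PG(2,2)), engine 1 / 1c over `186` (also duality)
(FAMILY-P5PLANE §3, `code/p5plane/mclasses.py`; class counts checked by verify-ref via Burnside). The reductions are sound because the system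
`FanoFive.IsSignSystem I m E Es R` (`FanoFiveSignSystem`) is transported along each symmetry — proved here:
* `IsSignSystem.dual`: `(I, m, E, E*, R) ↦ (Iᵀ, mᵀ, E*, E, Rᵀ)` (plane duality);
* `IsSignSystem.gauge_points` / `gauge_lines`: renaming the two line orbits at a fixed point `x` (flip row `x` of `m` and column `x` of `E`) /
  the two point orbits on a fixed line `μ` (flip column `μ` of `m` and of `E*`);
* `IsSignSystem.relabel`: relabelling fixed points by `π`, fixed lines by `ρ`, exterior point / line orbits by `α` / `β` transports a solution for `I`
  to one for `I ∘ (π × ρ)` — for a collineation of the labelled plane (`I ∘ (π × ρ) = I`) this is a symmetry of the system for `I` itself.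
Hence the solution set for `I` is a union of classes under gauge `×` Aut(`I`) (`×` duality composed with an isomorphism `Iᵀ ≅ I`), and 'no solution
with `m` in a set of class representatives' is equivalent to `NoSignSystem I` — the representatives themselves (`mclasses.json`) stay outside the kernel.
Nothing here asserts any census statement. No `sorry`, no new axioms.
-/

namespace Summit.Ventures.DiscreteObjects.PP12

open Finset

namespace FanoFive

/-- counting through a permutation of the index type -/
theorem card_filter_perm {n : ℕ} (β : Equiv.Perm (Fin n)) (p : Fin n → Prop) [DecidablePred p] :
    (univ.filter fun N => p (β N)).card = (univ.filter p).card := by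
  refine Finset.card_bij (fun N _ => β N) (fun N hN => ?_) (fun a _ b _ hab => β.injective hab) (fun N hN => ?_)
  · simp only [Finset.mem_filter, Finset.mem_univ, true_and] at hN ⊢
    exact hN
  · refine ⟨β.symm N, ?_, by simp⟩
    simp only [Finset.mem_filter, Finset.mem_univ, true_and] at hN ⊢
    simpa using hN

namespace IsSignSystem

variable {I : Fin 7 → Fin 7 → Bool} {m : Fin 7 → Fin 7 → ℤ} {E Es : Fin 16 → Fin 7 → ℤ} {R : Fin 16 → Fin 16 → ℤ}

/-- **duality**: the system is self-dual under `(I, m, E, E*, R) ↦ (Iᵀ, mᵀ, E*, E, Rᵀ)` -/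
theorem dual (h : IsSignSystem I m E Es R) : IsSignSystem (fun μ x => I x μ) (fun μ x => m x μ) Es E (fun N O => R O N) where
  m_flag := fun μ x hx => h.m_flag x μ hx
  m_antiflag := fun μ x hx => h.m_antiflag x μ hx
  E_sign := h.Es_sign
  Es_sign := h.E_sign
  R_range := fun N O => h.R_range O N
  E_balanced := h.Es_balanced
  Es_balanced := h.E_balanced
  R_row_profile := fun N => h.R_col_profile N
  R_col_profile := fun O => h.R_row_profile O
  gram_E := fun μ ν => h.gram_Es μ ν
  gram_Es := fun x y => h.gram_E x y
  gram_R_rows := fun N N' => h.gram_R_cols N N'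
  gram_R_cols := fun O O' => h.gram_R_rows O O'
  mixed_rows := fun N x => h.mixed_cols N x
  mixed_cols := fun O μ => h.mixed_rows O μ
  E_rows_ne := h.Es_rows_ne
  Es_rows_ne := h.E_rows_ne

/-- **gauge at the fixed points**: flipping row `x` of `m` and column `x` of `E` by signs `s x` preserves the system -/
theorem gauge_points (h : IsSignSystem I m E Es R) (s : Fin 7 → ℤ) (hs : ∀ x, s x = 1 ∨ s x = -1) :
    IsSignSystem I (fun x μ => s x * m x μ) (fun O x => s x * E O x) Es R := by
  have sign_mul_self : ∀ {x : Fin 7}, s x = 1 ∨ s x = -1 → s x * s x = 1 := fun hx => by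
    rcases hx with h1 | h1 <;> rw [h1] <;> norm_num
  exact {
  m_flag := fun x μ hx => by simp [h.m_flag x μ hx]
  m_antiflag := fun x μ hx => by
    rcases hs x with h1 | h1 <;> rcases h.m_antiflag x μ hx with h2 | h2 <;> simp [h1, h2]
  E_sign := fun O x => by
    rcases hs x with h1 | h1 <;> rcases h.E_sign O x with h2 | h2 <;> simp [h1, h2]
  Es_sign := h.Es_sign
  R_range := h.R_range
  E_balanced := fun x => by rw [← Finset.mul_sum, h.E_balanced x, mul_zero]
  Es_balanced := h.Es_balanced
  R_row_profile := h.R_row_profile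
  R_col_profile := h.R_col_profile
  gram_E := fun x y => by
    have e1 : ∑ O, s x * E O x * (s y * E O y) = (s x * s y) * ∑ O, E O x * E O y := by
      rw [Finset.mul_sum]; exact Finset.sum_congr rfl fun O _ => by ring
    have e2 : ∑ μ, s x * m x μ * (s y * m y μ) = (s x * s y) * ∑ μ, m x μ * m y μ := by
      rw [Finset.mul_sum]; exact Finset.sum_congr rfl fun μ _ => by ring
    rw [e1, e2, h.gram_E x y]
    by_cases hxy : x = y
    · subst hxy; rw [if_pos rfl, sign_mul_self (hs x)]; ring
    · rw [if_neg hxy]; ring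
  gram_Es := fun μ ν => by
    have e2 : ∑ x, s x * m x μ * (s x * m x ν) = ∑ x, m x μ * m x ν :=
      Finset.sum_congr rfl fun x _ => by rw [show s x * m x μ * (s x * m x ν) = (s x * s x) * (m x μ * m x ν) by ring, sign_mul_self (hs x), one_mul]
    rw [e2]; exact h.gram_Es μ ν
  gram_R_rows := fun O O' => by
    have e1 : ∑ x, s x * E O x * (s x * E O' x) = ∑ x, E O x * E O' x :=
      Finset.sum_congr rfl fun x _ => by rw [show s x * E O x * (s x * E O' x) = (s x * s x) * (E O x * E O' x) by ring, sign_mul_self (hs x), one_mul]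
    rw [e1]; exact h.gram_R_rows O O'
  gram_R_cols := h.gram_R_cols
  mixed_rows := fun O μ => by
    have e1 : ∑ x, s x * E O x * (s x * m x μ) = ∑ x, E O x * m x μ :=
      Finset.sum_congr rfl fun x _ => by rw [show s x * E O x * (s x * m x μ) = (s x * s x) * (E O x * m x μ) by ring, sign_mul_self (hs x), one_mul]
    rw [e1]; exact h.mixed_rows O μ
  mixed_cols := fun N x => by
    have e1 : ∑ O, R O N * (s x * E O x) = s x * ∑ O, R O N * E O x := by
      rw [Finset.mul_sum]; exact Finset.sum_congr rfl fun O _ => by ring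
    have e2 : ∑ μ, Es N μ * (s x * m x μ) = s x * ∑ μ, Es N μ * m x μ := by
      rw [Finset.mul_sum]; exact Finset.sum_congr rfl fun μ _ => by ring
    rw [e1, e2, h.mixed_cols N x]; ring
  E_rows_ne := fun O O' hne heq => h.E_rows_ne O O' hne (by
    funext x
    have e : s x * E O x = s x * E O' x := congrFun heq x
    rcases hs x with h1 | h1 <;> rw [h1] at e <;> linarith)
  Es_rows_ne := h.Es_rows_ne }

/-- **gauge at the fixed lines**: flipping column `μ` of `m` and of `E*` by signs `t μ` preserves the system (dual of `gauge_points`) -/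
theorem gauge_lines (h : IsSignSystem I m E Es R) (t : Fin 7 → ℤ) (ht : ∀ μ, t μ = 1 ∨ t μ = -1) :
    IsSignSystem I (fun x μ => t μ * m x μ) E (fun N μ => t μ * Es N μ) R :=
  (gauge_points h.dual t ht).dual

/-- **relabelling**: fixed points by `π`, fixed lines by `ρ`, exterior point orbits by `α`, exterior line orbits by `β` -/
theorem relabel (h : IsSignSystem I m E Es R) (π ρ : Equiv.Perm (Fin 7)) (α β : Equiv.Perm (Fin 16)) :
    IsSignSystem (fun x μ => I (π x) (ρ μ)) (fun x μ => m (π x) (ρ μ)) (fun O x => E (α O) (π x)) (fun N μ => Es (β N) (ρ μ))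
      (fun O N => R (α O) (β N)) where
  m_flag := fun x μ hx => h.m_flag (π x) (ρ μ) hx
  m_antiflag := fun x μ hx => h.m_antiflag (π x) (ρ μ) hx
  E_sign := fun O x => h.E_sign (α O) (π x)
  Es_sign := fun N μ => h.Es_sign (β N) (ρ μ)
  R_range := fun O N => h.R_range (α O) (β N)
  E_balanced := fun x => by rw [Equiv.sum_comp α (fun O => E O (π x))]; exact h.E_balanced (π x)
  Es_balanced := fun μ => by rw [Equiv.sum_comp β (fun N => Es N (ρ μ))]; exact h.Es_balanced (ρ μ)
  R_row_profile := fun O => by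
    rw [card_filter_perm β (fun N => R (α O) N = 2), card_filter_perm β (fun N => R (α O) N = 1)]
    exact h.R_row_profile (α O)
  R_col_profile := fun N => by
    rw [card_filter_perm α (fun O => R O (β N) = 2), card_filter_perm α (fun O => R O (β N) = 1)]
    exact h.R_col_profile (β N)
  gram_E := fun x y => by
    rw [Equiv.sum_comp α (fun O => E O (π x) * E O (π y)), Equiv.sum_comp ρ (fun μ => m (π x) μ * m (π y) μ), h.gram_E (π x) (π y)]
    simp only [EmbeddingLike.apply_eq_iff_eq]
  gram_Es := fun μ ν => by
    rw [Equiv.sum_comp β (fun N => Es N (ρ μ) * Es N (ρ ν)), Equiv.sum_comp π (fun x => m x (ρ μ) * m x (ρ ν)), h.gram_Es (ρ μ) (ρ ν)]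
    simp only [EmbeddingLike.apply_eq_iff_eq]
  gram_R_rows := fun O O' => by
    rw [Equiv.sum_comp β (fun N => R (α O) N * R (α O') N), Equiv.sum_comp π (fun x => E (α O) x * E (α O') x), h.gram_R_rows (α O) (α O')]
    simp only [EmbeddingLike.apply_eq_iff_eq]
  gram_R_cols := fun N N' => by
    rw [Equiv.sum_comp α (fun O => R O (β N) * R O (β N')), Equiv.sum_comp ρ (fun μ => Es (β N) μ * Es (β N') μ), h.gram_R_cols (β N) (β N')]
    simp only [EmbeddingLike.apply_eq_iff_eq]
  mixed_rows := fun O μ => by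
    rw [Equiv.sum_comp β (fun N => R (α O) N * Es N (ρ μ)), Equiv.sum_comp π (fun x => E (α O) x * m x (ρ μ))]
    exact h.mixed_rows (α O) (ρ μ)
  mixed_cols := fun N x => by
    rw [Equiv.sum_comp α (fun O => R O (β N) * E O (π x)), Equiv.sum_comp ρ (fun μ => Es (β N) μ * m (π x) μ)]
    exact h.mixed_cols (β N) (π x)
  E_rows_ne := fun O O' hne heq => h.E_rows_ne (α O) (α O') (α.injective.ne hne) (by
    funext y
    have := congrFun heq (π.symm y)
    simpa using this)
  Es_rows_ne := fun N N' hne heq => h.Es_rows_ne (β N) (β N') (β.injective.ne hne) (by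
    funext ν
    have := congrFun heq (ρ.symm ν)
    simpa using this)

end IsSignSystem

/-- **a collineation of the labelled plane is a symmetry of the system**: if `I (π x) (ρ μ) = I x μ` then solutions for `I` are transported to
solutions for `I` -/
theorem IsSignSystem.collineation {I : Fin 7 → Fin 7 → Bool} {m : Fin 7 → Fin 7 → ℤ} {E Es : Fin 16 → Fin 7 → ℤ} {R : Fin 16 → Fin 16 → ℤ}
    (h : IsSignSystem I m E Es R) (π ρ : Equiv.Perm (Fin 7)) (hI : ∀ x μ, I (π x) (ρ μ) = I x μ) (α β : Equiv.Perm (Fin 16)) :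
    IsSignSystem I (fun x μ => m (π x) (ρ μ)) (fun O x => E (α O) (π x)) (fun N μ => Es (β N) (ρ μ)) (fun O N => R (α O) (β N)) := by
  have h' := h.relabel π ρ α β
  have e : (fun x μ => I (π x) (ρ μ)) = I := funext fun x => funext fun μ => hI x μ
  rw [e] at h'
  exact h'

/-- hence `NoSignSystem` is invariant under relabelling: for isomorphic labelled incidences the statements agree -/
theorem noSignSystem_relabel {I : Fin 7 → Fin 7 → Bool} (h0 : NoSignSystem I) (π ρ : Equiv.Perm (Fin 7)) :
    NoSignSystem fun x μ => I (π x) (ρ μ) := by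
  intro m E Es R h
  have h' := h.relabel π.symm ρ.symm (Equiv.refl _) (Equiv.refl _)
  have e : (fun x μ => I (π (π.symm x)) (ρ (ρ.symm μ))) = I := funext fun x => funext fun μ => by simp
  rw [e] at h'
  exact h0 _ _ _ _ h'

/-- and under duality -/
theorem noSignSystem_dual {I : Fin 7 → Fin 7 → Bool} (h0 : NoSignSystem I) : NoSignSystem fun μ x => I x μ :=
  fun _ _ _ _ h => h0 _ _ _ _ h.dual

end FanoFive

end Summit.Ventures.DiscreteObjects.PP12
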